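import Mathlib
import HarnessLib
import Summits.AtomisticToContinuum.FouriersLaw.Theses.JunctionLocality
import Literature.MathematicalPhysics.KineticTheory.LangevinChainGibbs
import Summits.AtomisticToContinuum.FouriersLaw.Theorems.JunctionLocalitySuperadditiveResistanceKuboFrame
import Summits.AtomisticToContinuum.FouriersLaw.Theorems.JunctionLocalitySuperadditiveResistanceTerminationIdentity
import Summits.AtomisticToContinuum.FouriersLaw.Theorems.JunctionLocalitySuperadditiveResistanceStubTerminationLocalityAux2
import Summits.AtomisticToContinuum.FouriersLaw.Theorems.JunctionLocalitySuperadditiveResistanceStubFarTransmission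

/-!
# Far transmission, exact fixed-`N` identity — mirror form (the bare `M`-piece's factor)
(stub `stub_farTransmission` of line `thermalise-then-cut-probe-insertion`, skeleton v3.1, crux
`JunctionLocality.SuperadditiveResistance`, stmt-AtomisticToContinuum-11748)

Companion of `…StubFarTransmission.lean` (`helper_farTransmissionIdentity`:
`bypass g = (γ²/T²)⟨gb₄∘R, V'(q_N − q_{N−1})(∂_{p_{N−1}} g_N)∘π_N⟩_{μ_T^{(N+M)}}`, exhibiting the bare
`N`-piece's far-end gradient). By Onsager symmetry (`g 0 3 = g 3 0`, a clause of `KuboFrame`) and the landed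
block swap of `…StubTerminationLocalityAux2` (`gb₄∘Φ`, `gb₁∘Φ` are the bath-1 and bath-4 forward fields of the
swapped `(M, N)`-device), the same bypass is the far Green pairing of the SWAPPED split, which exhibits the
bare `M`-piece's factor `∂_{p_{M−1}} g_M` (left forward field of the bare `M`-chain, the field of its v3 plain
frame) against the device's bath-1 backward field: `helper_farTransmissionIdentityRight` (registered).
Fixed-`N` and exact; nothing is taken as a named fact.
-/

noncomputable section

open MeasureTheory Filter Topology ProbabilityTheory
open scoped ContDiff NNReal ENNReal
open Literature.MathematicalPhysics.KineticTheory.HeatConduction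
open Summit.AtomisticToContinuum.FouriersLaw.Theorems.SuperadditiveResistance.TerminationLocality
  (memLp_comp_restrictLeft)
open Summit.AtomisticToContinuum.FouriersLaw.Theorems.SuperadditiveResistance.Kubo (memLp_kinetic)

namespace Summit.AtomisticToContinuum.FouriersLaw.Cruxes.SuperadditiveResistance.ThermaliseThenCutProbeInsertion

/-! ## The mirror identity (the bare `M`-piece's factor) by the block swap and Onsager symmetry -/

section Mirror

open Summit.AtomisticToContinuum.FouriersLaw.Theorems.SuperadditiveResistance.TerminationLocality
  (blockSwap kin_blockSwap deviceGenerator_comp_blockSwap_const integral_gibbsMeasure_comp_blockSwap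
    memLp_comp_blockSwap pinnedChain_V_even)

/-- **FAR-TRANSMISSION IDENTITY, mirror form (fixed `N`, `M`; exact; v3 vocabulary).** By Onsager
symmetry (`g 0 3 = g 3 0`, a clause of `KuboFrame`) the bypass is also bath 4's Kubo row at bath 1,
`x = (γ²/T²)⟨gb₄, p_0² − T⟩`, and the identity `helper_farTransmissionIdentity` of the SWAPPED split
`(M, N)` (site reversal `Φ : (q, p) ↦ (q∘σ, p∘σ)`, `σ i = M+N−1−i`; `gb₄∘Φ`, `gb₁∘Φ` are the bath-1 and
bath-4 forward fields of the `(M, N)`-device, landed block swap `…StubTerminationLocalityAux2`) exhibits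
the bare `M`-piece's factor instead: for EVERY classical forward field `g_M` of the bare `M`-piece's LEFT
bath (as in its v3 plain frame at `L = M`),

  `bypass g = (γ²/T²) · ⟨(gb₁∘Φ)∘R, V'(q_M − q_{M−1}) · (∂_{p_{M−1}} g_M)∘π_M⟩_{μ_T^{(M+N)}}`

(all on the swapped device; `ω₂ > 0`, `lam, β ≥ 0`, `γ, T > 0`, `N, M ≥ 1`). Together with
`helper_farTransmissionIdentity` the two "escape" factors `∂_{p_{N−1}} g_N` and `∂_{p_{M−1}} g_M` of the
double-escape heuristic are each exhibited exactly once. -/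
theorem helper_farTransmissionIdentityRight : ∀ (ω₂ lam β γ T : ℝ), 0 < ω₂ → 0 ≤ lam → 0 ≤ β → 0 < γ → 0 < T → ∀ (N M : ℕ) (hN : 1 ≤ N) (hM : 1 ≤ M) (g : Fin 4 → Fin 4 → ℝ) (gb₁ gb₄ : PhaseSpace (N + M) → ℝ) (gM : PhaseSpace M → ℝ), KuboFrame (pinnedChain ω₂ lam β γ) T N M g gb₁ gb₄ → ContDiff ℝ 2 gM → MemLp gM 2 ((pinnedChain ω₂ lam β γ).gibbsMeasure M T) → (∀ y, (pinnedChain ω₂ lam β γ).generator M T T gM y = -(kin M 0 y - T)) → bypass g = γ ^ 2 / T ^ 2 * ∫ z, gb₁ ((fun i : Fin (N + M) => z.1 ⟨M + N - 1 - i.val, by omega⟩), (fun i : Fin (N + M) => -z.2 ⟨M + N - 1 - i.val, by omega⟩)) * (((z.1 ⟨M, by omega⟩ - z.1 ⟨M - 1, by omega⟩) + β * (z.1 ⟨M, by omega⟩ - z.1 ⟨M - 1, by omega⟩) ^ 3) * partialP ⟨M - 1, by omega⟩ gM (z.1 ∘ Fin.castAdd N, z.2 ∘ Fin.castAdd N))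 ∂((pinnedChain ω₂ lam β γ).gibbsMeasure (M + N) T) := by
  intro ω₂ lam β γ T hω hl hβ hγ hT N M hN hM g gb₁ gb₄ gM hKF hgC hgL2 hgpde
  set P := pinnedChain ω₂ lam β γ with hP
  have hV : ∀ r, P.V (-r) = P.V r := pinnedChain_V_even ω₂ lam β γ
  obtain ⟨hsym, -, hff1, hff4, -, -, hK4, -⟩ := hKF
  obtain ⟨h1C, h1L2, -, -, h1pde⟩ := hff1
  obtain ⟨h4C, h4L2, -, -, h4pde⟩ := hff4
  -- the swapped forward fields: `gb₄ ∘ Φ` (bath 1) and `gb₁ ∘ Φ` (bath 4) of the `(M, N)`-device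
  set gb : PhaseSpace (M + N) → ℝ := gb₄ ∘ blockSwap M N with hgb
  set gb' : PhaseSpace (M + N) → ℝ := gb₁ ∘ blockSwap M N with hgb'
  have hbC : ContDiff ℝ 2 gb := h4C.comp (blockSwap M N).contDiff
  have hbC' : ContDiff ℝ 2 gb' := h1C.comp (blockSwap M N).contDiff
  have hbL2 : MemLp gb 2 (P.gibbsMeasure (M + N) T) := memLp_comp_blockSwap P hV T h4L2
  have hbL2' : MemLp gb' 2 (P.gibbsMeasure (M + N) T) := memLp_comp_blockSwap P hV T h1L2
  have hdev : ∀ (f : PhaseSpace (N + M) → ℝ) (z : PhaseSpace (M + N)),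
      deviceGenerator P M N (fun _ => T) (f ∘ blockSwap M N) z = deviceGenerator P N M (fun _ => T) f (blockSwap M N z) := by
    intro f z
    have e1 : deviceGenerator P M N (fun _ => T) (f ∘ blockSwap M N) z =
        Summit.AtomisticToContinuum.FouriersLaw.Theorems.SuperadditiveResistance.DeviceLiouville.deviceGenerator
          P M N (fun _ => T) (f ∘ blockSwap M N) z := rfl
    rw [e1, deviceGenerator_comp_blockSwap_const P hV hM hN T f z]
    rfl
  have hbpde : ∀ z, deviceGenerator P M N (fun _ => T) gb z = -(kin (M + N) 0 z - T) := by
    intro z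
    have e4 := kin_blockSwap (N := M) (M := N) (s := 0) (s' := N + M - 1) (by omega) (by omega) z
    rw [hgb, hdev, h4pde]
    exact congrArg (fun t => -(t - T)) e4
  have hbpde' : ∀ z, deviceGenerator P M N (fun _ => T) gb' z = -(kin (M + N) (M + N - 1) z - T) := by
    intro z
    have e4 := kin_blockSwap (N := M) (M := N) (s := M + N - 1) (s' := 0) (by omega) (by omega) z
    rw [hgb', hdev, h1pde]
    exact congrArg (fun t => -(t - T)) e4
  -- Onsager symmetry and bath 4's Kubo row at bath 1 (terminal `0`, site `0`), moved to the swapped device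
  have hx : bypass g = P.γ ^ 2 / T ^ 2 * ∫ z, gb z * (kin (M + N) (M + N - 1) z - T) ∂(P.gibbsMeasure (M + N) T) := by
    have h := hK4 0 (by decide)
    have e : termSite N M 0 = 0 := rfl
    rw [e] at h
    unfold bypass
    rw [hsym 0 3, h, ← integral_gibbsMeasure_comp_blockSwap P hV T (fun x => gb₄ x * (kin (N + M) 0 x - T))]
    congr 1
    refine integral_congr_ae (ae_of_all _ fun z => ?_)
    have e4 := kin_blockSwap (N := M) (M := N) (s := M + N - 1) (s' := 0) (by omega) (by omega) z
    dsimp only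
    rw [show Summit.AtomisticToContinuum.FouriersLaw.Theorems.SuperadditiveResistance.DeviceLiouville.kin
      (N + M) 0 (blockSwap M N z) = kin (N + M) 0 (blockSwap M N z) from rfl] at e4
    rw [e4]
    rfl
  -- the identity on the swapped device
  have hD := farDefect_pairing hω hl hβ hγ hM hN hT hbC hbL2 hbpde hbC' hbL2' hbpde' hgC hgL2 hgpde
  have h0 := integral_comp_restrictLeft_mul_kin_far (M := N) hω hl hβ γ hM hN hT
    (hgC.of_le (by norm_cast) : ContDiff ℝ 1 gM) hgL2
  have hk : MemLp (fun z : PhaseSpace (M + N) => kin (M + N) (M + N - 1) z - T) 2 (P.gibbsMeasure (M + N) T) := by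
    have e : (fun z : PhaseSpace (M + N) => kin (M + N) (M + N - 1) z - T) =
        fun z => z.2 ⟨M + N - 1, by omega⟩ ^ 2 - T := by
      funext z; rw [kin_eq_sq_line (show M + N - 1 < M + N by omega)]
    rw [e]; exact memLp_kinetic (γ := γ) hω hl hβ (M + N) hT ⟨M + N - 1, by omega⟩
  have hgMπ : MemLp (fun z : PhaseSpace (M + N) => gM (z.1 ∘ Fin.castAdd N, z.2 ∘ Fin.castAdd N)) 2
      (P.gibbsMeasure (M + N) T) := memLp_comp_restrictLeft hω hl hβ γ hM hN hT hgL2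
  have hI1 : Integrable (fun z => (gb z - gM (z.1 ∘ Fin.castAdd N, z.2 ∘ Fin.castAdd N)) *
      (kin (M + N) (M + N - 1) z - T)) (P.gibbsMeasure (M + N) T) := (hbL2.sub hgMπ).integrable_mul hk
  have hI2 : Integrable (fun z => gM (z.1 ∘ Fin.castAdd N, z.2 ∘ Fin.castAdd N) *
      (kin (M + N) (M + N - 1) z - T)) (P.gibbsMeasure (M + N) T) := hgMπ.integrable_mul hk
  have hsplit : ∫ z, gb z * (kin (M + N) (M + N - 1) z - T) ∂(P.gibbsMeasure (M + N) T) =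
      (∫ z, (gb z - gM (z.1 ∘ Fin.castAdd N, z.2 ∘ Fin.castAdd N)) * (kin (M + N) (M + N - 1) z - T)
        ∂(P.gibbsMeasure (M + N) T)) +
        ∫ z, gM (z.1 ∘ Fin.castAdd N, z.2 ∘ Fin.castAdd N) * (kin (M + N) (M + N - 1) z - T)
          ∂(P.gibbsMeasure (M + N) T) := by
    rw [← integral_add hI1 hI2]
    exact integral_congr_ae (ae_of_all _ fun z => by ring)
  rw [hx, hsplit, hD, h0, add_zero]
  rfl

end Mirror

end Summit.AtomisticToContinuum.FouriersLaw.Cruxes.SuperadditiveResistance.ThermaliseThenCutProbeInsertion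

end
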